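import Summits.KontsevichZagierPeriods.KontsevichZagierPeriods.Theorems.RealEllipticSectorKernel.Negative.Core

/-!
# `RealEllipticSectorKernel` (stmt-KontsevichZagierPeriods-10632), negative side: roots and ovals of `y² = 4x³ − 44x + 56`

Support lemmas for the cdisprove finding F9 (`Negative/IsogenyCM66.lean`, `Negative/CMPoint.lean`):
the CM curve `f = 4x³ − 44x + 56 = 4(x − 2)(x² + 2x − 7)` (`(q₂,q₃) = (44,−56)`, `j = 66³`) has
roots `e₃ = −1 − 2√2 < e₂ = −1 + 2√2 < e₁ = 2`; the sign pattern of `f` identifies the crux's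
root-free ovals with the intervals `(e₃,e₂)` and `(e₂,2)` (`sigma_cm_iff`, `sigma'_cm_iff`).
Elementary real algebra (`√2` bounds `1.41 < √2 < 1.42`).

Sources: M. Kontsevich, D. Zagier, *Periods* (2001), §§1.1–1.2; J. Vélu, *Isogénies entre courbes
elliptiques*, C. R. Acad. Sci. Paris 273 (1971) 238–241; D. Masser, *Elliptic Functions and
Transcendence*, LNM 437 (1975), Ch. III. -/

noncomputable section

namespace Summit.KontsevichZagierPeriods.RealEllipticSectorKernel.CM66

open Set

open MeasureTheory Set

/-! ### The CM curve `(q₂,q₃) = (44, −56)`: `f = 4x³ − 44x + 56 = 4(x−2)(x²+2x−7)`, `j = 66³` -/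

/-- `f(x) = 4x³ − 44x + 56`. [folklore] -/
def fcm (x : ℝ) : ℝ := 4 * x ^ 3 - 44 * x + 56

/-- middle root `e₂ = −1 + 2√2`. [folklore] -/
def e₂ : ℝ := -1 + 2 * Real.sqrt 2
/-- smallest root `e₃ = −1 − 2√2`. [folklore] -/
def e₃ : ℝ := -1 - 2 * Real.sqrt 2

/-- Auxiliary step of the isogeny / two-torsion computation (F9–F10). [folklore] -/
theorem sqrt2_sq : Real.sqrt 2 ^ 2 = 2 := Real.sq_sqrt (by norm_num)

/-- Auxiliary step of the isogeny / two-torsion computation (F9–F10). [folklore] -/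
theorem sqrt2_gt : (1.41 : ℝ) < Real.sqrt 2 := by
  rw [show (1.41:ℝ) = Real.sqrt (1.41 ^ 2) by rw [Real.sqrt_sq (by norm_num)]]
  exact Real.sqrt_lt_sqrt (by norm_num) (by norm_num)

/-- Auxiliary step of the isogeny / two-torsion computation (F9–F10). [folklore] -/
theorem sqrt2_lt : Real.sqrt 2 < (1.42 : ℝ) := by
  rw [show (1.42:ℝ) = Real.sqrt (1.42 ^ 2) by rw [Real.sqrt_sq (by norm_num)]]
  exact Real.sqrt_lt_sqrt (by norm_num) (by norm_num)

/-- Auxiliary step of the isogeny / two-torsion computation (F9–F10). [folklore] -/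
theorem fcm_factor (x : ℝ) : fcm x = 4 * (x - 2) * ((x - e₂) * (x - e₃)) := by
  have h : (x - e₂) * (x - e₃) = (x + 1) ^ 2 - 4 * Real.sqrt 2 ^ 2 := by
    unfold e₂ e₃; ring
  rw [h, sqrt2_sq]
  unfold fcm
  ring

/-- Auxiliary step of the isogeny / two-torsion computation (F9–F10). [folklore] -/
theorem e₃_lt_e₂ : e₃ < e₂ := by unfold e₂ e₃; nlinarith [sqrt2_gt]
/-- Auxiliary step of the isogeny / two-torsion computation (F9–F10). [folklore] -/
theorem e₂_lt_two : e₂ < 2 := by unfold e₂; nlinarith [sqrt2_lt]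
/-- Auxiliary step of the isogeny / two-torsion computation (F9–F10). [folklore] -/
theorem one_lt_e₂ : 1 < e₂ := by unfold e₂; nlinarith [sqrt2_gt]
/-- Auxiliary step of the isogeny / two-torsion computation (F9–F10). [folklore] -/
theorem e₂_lt_19 : e₂ < 1.9 := by unfold e₂; nlinarith [sqrt2_lt]
/-- Auxiliary step of the isogeny / two-torsion computation (F9–F10). [folklore] -/
theorem e₃_lt_one : e₃ < 1 := by unfold e₃; nlinarith [sqrt2_gt]

/-- sign of `f` on `(e₃, e₂)`. [folklore] -/
theorem fcm_pos_of_mem {x : ℝ} (h3 : e₃ < x) (h2 : x < e₂) : 0 < fcm x := by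
  rw [fcm_factor]
  have hx2 : x - 2 < 0 := by linarith [e₂_lt_two]
  have hq : (x - e₂) * (x - e₃) < 0 := mul_neg_of_neg_of_pos (by linarith) (by linarith)
  nlinarith

/-- sign of `f` on `(e₂, 2)`. [folklore] -/
theorem fcm_neg_of_mem {x : ℝ} (h2 : e₂ < x) (h : x < 2) : fcm x < 0 := by
  rw [fcm_factor]
  have hx2 : x - 2 < 0 := by linarith
  have hq : 0 < (x - e₂) * (x - e₃) := mul_pos (by linarith) (by linarith [e₃_lt_e₂])
  nlinarith

/-- `f t < 0 ⇒ t < 2`. [folklore] -/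
theorem lt_two_of_fcm_neg {t : ℝ} (ht : fcm t < 0) : t < 2 := by
  by_contra h
  push Not at h
  rw [fcm_factor] at ht
  have h1 : 0 ≤ t - 2 := by linarith
  have h2 : 0 ≤ (t - e₂) * (t - e₃) :=
    mul_nonneg (by linarith [e₂_lt_two]) (by linarith [e₃_lt_e₂, e₂_lt_two])
  nlinarith [mul_nonneg h1 h2]

/-- `0 < f x`, `x < 2` ⇒ `e₃ < x < e₂`. [folklore] -/
theorem mem_of_fcm_pos_of_lt_two {x : ℝ} (hx : 0 < fcm x) (h2 : x < 2) : e₃ < x ∧ x < e₂ := by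
  rw [fcm_factor] at hx
  have hx2 : x - 2 < 0 := by linarith
  have hq : (x - e₂) * (x - e₃) < 0 := by nlinarith
  constructor
  · by_contra h; push Not at h
    have : 0 ≤ (x - e₂) * (x - e₃) :=
      mul_nonneg_of_nonpos_of_nonpos (by linarith [e₃_lt_e₂]) (by linarith)
    linarith
  · by_contra h; push Not at h
    have : 0 ≤ (x - e₂) * (x - e₃) := mul_nonneg (by linarith) (by linarith [e₃_lt_e₂])
    linarith

/-- `f x < 0`, `x < 2` ⇒ `x < e₃ ∨ e₂ < x`. [folklore] -/
theorem of_fcm_neg_of_lt_two {x : ℝ} (hx : fcm x < 0) (h2 : x < 2) : x < e₃ ∨ e₂ < x := by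
  rw [fcm_factor] at hx
  have hx2 : x - 2 < 0 := by linarith
  have hq : 0 < (x - e₂) * (x - e₃) := by nlinarith
  by_contra h
  push Not at h
  have : (x - e₂) * (x - e₃) ≤ 0 := mul_nonpos_of_nonpos_of_nonneg (by linarith [h.2]) (by linarith [h.1])
  linarith

/-- The crux's root-free `σ` at `(44,−56)` is `(e₃, e₂)` (ℝ-level). [folklore] -/
theorem sigma_cm_iff (x : ℝ) : (0 < fcm x ∧ ∃ t : ℝ, x < t ∧ fcm t < 0) ↔ e₃ < x ∧ x < e₂ := by
  constructor
  · rintro ⟨hx, t, hxt, ht⟩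
    exact mem_of_fcm_pos_of_lt_two hx (hxt.trans (lt_two_of_fcm_neg ht))
  · rintro ⟨h3, h2⟩
    refine ⟨fcm_pos_of_mem h3 h2, 1.9, h2.trans e₂_lt_19, ?_⟩
    norm_num [fcm]

/-- The crux's root-free `σ'` at `(44,−56)` is `(e₂, 2)` (ℝ-level). [folklore] -/
theorem sigma'_cm_iff (x : ℝ) : (fcm x < 0 ∧ ∃ t : ℝ, t < x ∧ 0 < fcm t) ↔ e₂ < x ∧ x < 2 := by
  constructor
  · rintro ⟨hx, t, htx, ht⟩
    have hx2 := lt_two_of_fcm_neg hx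
    rcases of_fcm_neg_of_lt_two hx hx2 with h | h
    · exfalso
      have ht3 : t < e₃ := htx.trans h
      rw [fcm_factor] at ht
      have : (t - 2) < 0 := by linarith [e₃_lt_e₂, e₂_lt_two]
      have hq : 0 < (t - e₂) * (t - e₃) :=
        mul_pos_of_neg_of_neg (by linarith [e₃_lt_e₂]) (by linarith)
      nlinarith
    · exact ⟨h, hx2⟩
  · rintro ⟨h2, hx2⟩
    refine ⟨fcm_neg_of_mem h2 hx2, 0, by linarith [one_lt_e₂], by norm_num [fcm]⟩

/-- Auxiliary step of the isogeny / two-torsion computation (F9–F10). [folklore] -/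
theorem quad_factor (x : ℝ) : (x - e₂) * (x - e₃) = x ^ 2 + 2 * x - 7 := by
  have h : (x - e₂) * (x - e₃) = (x + 1) ^ 2 - 4 * Real.sqrt 2 ^ 2 := by
    unfold e₂ e₃; ring
  rw [h, sqrt2_sq]; ring

end Summit.KontsevichZagierPeriods.RealEllipticSectorKernel.CM66

end
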